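import Summits.BirchSwinnertonDyer.BirchSwinnertonDyer.Theorems.BiquadraticEisensteinDescentManinDatumSupercuspidalCMInertSevenDivisionEisenstein
import Literature.NumberTheory.EllipticCurves.EisensteinValuesAtRhoSix
import HarnessLib

set_option linter.dupNamespace false -- `Summit.BirchSwinnertonDyer.BirchSwinnertonDyer.Theorems.…` (summit = sub, D-0017)
set_option autoImplicit false

/-!
# Crux `ManinDatumSupercuspidalCMInert` (stmt-BirchSwinnertonDyer-20111, BED r605), stub `stub_S5` (`j = 0` at `p = 5`): the
# `5`-division polynomial of `y² = x³ − 1` is EISENSTEIN AT `5` (supersingular reduction), so the `5`-division values of the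
# equianharmonic `℘` have `5`-adic order exactly `−1/12` (and `x/y` has order `1/24`)

Route `BiquadraticEisensteinDescent` (cell `pub/bsd-wall`, width seat `bsd-wall-cm-bed-w1` g8; `--supports` stmt-BirchSwinnertonDyer-20111,
helper). THEOREMS ONLY (no definition, no named fact, no `sorry`); nothing is closed by this file and BSD is not proved by any of it.

This is the `j = 0` / `p = 5` twin of `…ManinDatumSupercuspidalCMInertSevenDivisionEisenstein` (bed-w4 g10, the `j = 1728` / `p = 7` cell of
`stub_S7`): the first CM-side brick of the registered stub `stub_S5` (Kodaira `II`, `IV`, `IV*`, `II*` at `5` for `y² = x³ + B`, `5 ∣ B`), whose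
E-side (a `ℤ[ω]` theta dictionary) does not exist in the tree yet. The tame resolvent count behind the would-be core `Core₅`
(`v₅ ≥ 1 − k/6` for the `(·/5)₆^k`-weighted `5`-torsion sums, `k = v₅(B) ∈ {1, 2, 4, 5}`; certified exactly by kit job j310442, memo
`Cruxes/ManinDatumSupercuspidalCMInert/KIT-RES-CERT-w1g8.md`) consumes, through `…TameResolvent.resolvent_valuation_le` with `e = 24`, exactly the
valuation input typed here:

* `preΨ'_five_equianharmonic` — **the `5`-division polynomial of `W₀ = ⟨0,0,0,0,−1⟩` (`y² = x³ − 1`) EXPLICITLY**: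
  `ψ₅ = 5X¹² − 380X⁹ − 240X⁶ + 1600X³ − 256` (Mathlib's `preΨ'_odd` at `5` over `Ψ₂Sq = 4X³ − 4`, `Ψ₃ = 3X⁴ − 12X`, `preΨ₄ = 2X⁶ − 40X³ − 16`);
  every coefficient but the constant `−256 = −2⁸` is divisible by `5` — the reversed polynomial in `u = 1/X³` is Eisenstein at `5`
  (supersingularity of `y² = x³ − 1` at `5 ≡ 2 (mod 3)`); `ΨSq_five_equianharmonic`: `ΨSq₅ = ψ₅²`;
* `val_inv_pow_of_psi_five` — for ANY valued field `(F, v)` with `v 5 < 1` and any root `x` of `ψ₅`: `x ≠ 0` and `v(x⁻¹)¹² = v 5`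
  (`valuation_root_of_eisenstein` on `u = x⁻³`, `n = 4`); with `y² = x³ − 1` also `y ≠ 0` and `v(x/y)²⁴ = v 5` (`val_div_pow_of_psi_five`);
* `four_mul_varpi_pow_six` — `g₃(ℤρ + ℤ) = 4ϖ₁⁶` for the equianharmonic constant `ϖ₁ = 2^{2/3}Γ(1/3)³/(4π) = Γ(1/3)³/(2^{4/3}π)`
  (`EisensteinLattice.g₃_eq_Gamma`), so that `x = ℘(w)/ϖ₁²`, `y = ℘′(w)/(2ϖ₁³)` put `ℂ/(ℤρ + ℤ)` on `y² = x³ − 1`;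
* ★ `val_weierstrassP_five_div_rho` — **the `5`-division values of the equianharmonic `℘`**: for `w ∉ Λ = ℤρ + ℤ` with `5w ∈ Λ`,
  `x = ℘(w)/ϖ₁²`, `y = ℘′(w)/(2ϖ₁³)` satisfy `ψ₅(x) = 0`, `y² = x³ − 1` (`psi_five_weierstrassP_div_rho`, via
  `PeriodPair.aeval_weierstrassP_ΨSq_eq_zero` on `ϖ₁Λ`), hence for EVERY valuation `v` of `ℂ` with `v 5 < 1`: `x ≠ 0`, `y ≠ 0`,
  `v(x⁻¹)¹² = v 5` and `v(x/y)²⁴ = v 5` — the `5`-torsion layer of `y² = x³ − 1` over `ℚ₅(ω)` is totally ramified of degree `24`.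

References: [SilvermanAEC2009] Ex. 3.7, Prop. VI.3.6, Thm. V.3.1 (supersingular ⟺ no `p`-torsion); [Serre1979] Ch. I §6 (Eisenstein
polynomials); [Waldschmidt2008EllipticSurvey] §2.3 (6) (`g₃(ℤ[ρ]) = 4ω₁⁶`).
-/

noncomputable section

open Polynomial Complex

namespace Summit.BirchSwinnertonDyer.BirchSwinnertonDyer.Theorems.BiquadraticEisensteinDescentManinDatumSupercuspidalCMInertFiveDivisionEisensteinJZero

open Summit.BirchSwinnertonDyer.BirchSwinnertonDyer.Theorems.BiquadraticEisensteinDescentManinDatumSupercuspidalCMInertTameResolvent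
  (valuation_root_of_eisenstein)
open Summit.BirchSwinnertonDyer.BirchSwinnertonDyer.Theorems.BiquadraticEisensteinDescentManinDatumSupercuspidalCMInertSevenDivisionEisenstein
  (val_intCast_le_one)

/-! ## §1 The division polynomials of `y² = x³ − 1` up to `ψ₅` -/

/-- The `b`-invariants of `⟨0,0,0,0,−1⟩`: `b₂ = 0`, `b₄ = 0`, `b₆ = −4`, `b₈ = 0`. [folklore] -/
theorem b_equianharmonic :
    (⟨0, 0, 0, 0, -1⟩ : WeierstrassCurve ℤ).b₂ = 0 ∧ (⟨0, 0, 0, 0, -1⟩ : WeierstrassCurve ℤ).b₄ = 0 ∧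
    (⟨0, 0, 0, 0, -1⟩ : WeierstrassCurve ℤ).b₆ = -4 ∧ (⟨0, 0, 0, 0, -1⟩ : WeierstrassCurve ℤ).b₈ = 0 := by
  refine ⟨?_, ?_, ?_, ?_⟩ <;>
  simp [WeierstrassCurve.b₂, WeierstrassCurve.b₄, WeierstrassCurve.b₆, WeierstrassCurve.b₈]

/-- `Ψ₂Sq = 4X³ − 4` for `y² = x³ − 1`. [folklore] -/
theorem Ψ₂Sq_equianharmonic : (⟨0, 0, 0, 0, -1⟩ : WeierstrassCurve ℤ).Ψ₂Sq = 4 * X ^ 3 - 4 := by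
  obtain ⟨h2, h4, h6, -⟩ := b_equianharmonic
  rw [WeierstrassCurve.Ψ₂Sq, h2, h4, h6]
  simp; ring

/-- `ψ₃ = 3X⁴ − 12X` for `y² = x³ − 1`. [folklore] -/
theorem Ψ₃_equianharmonic : (⟨0, 0, 0, 0, -1⟩ : WeierstrassCurve ℤ).Ψ₃ = 3 * X ^ 4 - 12 * X := by
  obtain ⟨h2, h4, h6, h8⟩ := b_equianharmonic
  rw [WeierstrassCurve.Ψ₃, h2, h4, h6, h8]
  simp; ring

/-- `preΨ₄ = 2X⁶ − 40X³ − 16` for `y² = x³ − 1`. [folklore] -/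
theorem preΨ₄_equianharmonic :
    (⟨0, 0, 0, 0, -1⟩ : WeierstrassCurve ℤ).preΨ₄ = 2 * X ^ 6 - 40 * X ^ 3 - 16 := by
  obtain ⟨h2, h4, h6, h8⟩ := b_equianharmonic
  rw [WeierstrassCurve.preΨ₄, h2, h4, h6, h8]
  simp; ring

/-- **The `5`-division polynomial of `y² = x³ − 1`**: `ψ₅ = 5X¹² − 380X⁹ − 240X⁶ + 1600X³ − 256` (`ψ₅ = preΨ₄Ψ₂Sq² − ψ₃³`). All
coefficients except the constant term `−256` are divisible by `5`. [cite: SilvermanAEC2009, Exercise 3.7 (p. 105)] -/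
theorem preΨ'_five_equianharmonic : (⟨0, 0, 0, 0, -1⟩ : WeierstrassCurve ℤ).preΨ' 5 =
    5 * X ^ 12 - 380 * X ^ 9 - 240 * X ^ 6 + 1600 * X ^ 3 - 256 := by
  set W : WeierstrassCurve ℤ := ⟨0, 0, 0, 0, -1⟩ with hW
  have h5 : W.preΨ' 5 = W.preΨ₄ * W.Ψ₂Sq ^ 2 - W.Ψ₃ ^ 3 := by
    rw [show (5 : ℕ) = 2 * (0 + 2) + 1 from rfl, W.preΨ'_odd 0]
    simp
  rw [h5, hW, Ψ₂Sq_equianharmonic, Ψ₃_equianharmonic, preΨ₄_equianharmonic]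
  ring

/-- `ΨSq₅ = ψ₅²` for `y² = x³ − 1` (`5` is odd). [folklore] -/
theorem ΨSq_five_equianharmonic : (⟨0, 0, 0, 0, -1⟩ : WeierstrassCurve ℤ).ΨSq ((5 : ℕ) : ℤ) =
    (⟨0, 0, 0, 0, -1⟩ : WeierstrassCurve ℤ).preΨ' 5 ^ 2 := by
  rw [WeierstrassCurve.ΨSq_ofNat]
  simp [show ¬ Even 5 by decide]

/-! ## §2 Eisenstein at `5`: roots of `ψ₅` in a valued field -/

section Valued

variable {F Γ₀ : Type*} [Field F] [LinearOrderedCommGroupWithZero Γ₀] (v : Valuation F Γ₀)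

/-- If `v 5 < 1` then `v 2 = 1` (`1 = 5 − 2·2`). [folklore] -/
theorem val_two_eq_one (h5 : v 5 < 1) : v (2 : F) = 1 := by
  have h2 : v (2 : F) ≤ 1 := by exact_mod_cast val_intCast_le_one v 2
  by_contra hne
  have hlt : v (2 : F) < 1 := lt_of_le_of_ne h2 hne
  have h1 : (1 : F) = 5 + -(2 * 2) := by norm_num
  have : v (1 : F) < 1 := by
    rw [h1]
    refine lt_of_le_of_lt (Valuation.map_add v _ _) (max_lt h5 ?_)
    rw [Valuation.map_neg, Valuation.map_mul]
    calc v (2 : F) * v 2 < 1 * 1 := mul_lt_mul'' hlt hlt zero_le zero_le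
      _ = 1 := one_mul 1
  rw [Valuation.map_one] at this
  exact lt_irrefl _ this

/-- **Roots of `ψ₅` have `v(x⁻¹)¹² = v 5`.** If `v 5 < 1` and `x` satisfies `5x¹² − 380x⁹ − 240x⁶ + 1600x³ − 256 = 0` in `F`, then
`x ≠ 0` and `v(x⁻¹)¹² = v 5`: the monic polynomial in `u = x⁻³`, `u⁴ − (25/4)u³ + (15/16)u² + (95/64)u − 5/256`, is Eisenstein at `5`
(`2` is a `v`-unit). [cite: Serre1979, Ch. I §6] [cite: SilvermanAEC2009, Thm. V.3.1] -/
theorem val_inv_pow_of_psi_five (h5 : v 5 < 1) {x : F}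
    (hx : 5 * x ^ 12 - 380 * x ^ 9 - 240 * x ^ 6 + 1600 * x ^ 3 - 256 = 0) :
    x ≠ 0 ∧ v x⁻¹ ^ 12 = v 5 := by
  have h2 : v (2 : F) = 1 := val_two_eq_one v h5
  have h20 : (2 : F) ≠ 0 := fun h ↦ by rw [h, Valuation.map_zero] at h2; exact zero_ne_one h2
  have h256 : (256 : F) ≠ 0 := by
    have : (256 : F) = 2 ^ 8 := by norm_num
    rw [this]; exact pow_ne_zero _ h20
  have hv256 : v (256 : F) = 1 := by
    rw [show (256 : F) = 2 ^ 8 by norm_num, Valuation.map_pow, h2, one_pow]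
  have hx0 : x ≠ 0 := by
    rintro rfl
    apply h256
    have : (-(256 : F)) = 0 := by simpa using hx
    exact neg_eq_zero.mp this
  refine ⟨hx0, ?_⟩
  -- the coefficients `a_i` of `u⁴ = −Σ a_i u^i`, `u = x⁻³`: `a_i = 5 · m_i / 256`
  let m : ℕ → ℤ := fun i ↦ if i = 0 then -1 else if i = 1 then 76 else if i = 2 then 48 else if i = 3 then -320 else 0
  let a : ℕ → F := fun i ↦ 5 * ((m i : ℤ) : F) / 256
  have ha0 : a 0 = -(5 / 256) := by simp [a, m]; ring
  have hroot : (x⁻¹ ^ 3) ^ 4 = -∑ i ∈ Finset.range 4, a i * (x⁻¹ ^ 3) ^ i := by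
    simp only [Finset.sum_range_succ, Finset.sum_range_zero, a, m]
    simp only [show (1:ℕ) ≠ 0 from one_ne_zero, if_true, if_false]
    norm_num
    field_simp
    linear_combination (-1 : F) * hx
  have hbound : ∀ i < 4, v (a i) ≤ v (a 0) := by
    intro i _
    have hai : v (a i) = v 5 * v ((m i : ℤ) : F) / v 256 := by
      show v (5 * ((m i : ℤ) : F) / 256) = _
      rw [map_div₀, Valuation.map_mul]
    rw [hai, ha0, Valuation.map_neg, map_div₀, div_eq_mul_inv, div_eq_mul_inv]
    exact mul_le_mul' (mul_le_of_le_one_right' (val_intCast_le_one v (m i))) le_rfl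
  have hlt : v (a 0) < 1 := by rw [ha0, Valuation.map_neg, map_div₀, hv256, div_one]; exact h5
  have h := valuation_root_of_eisenstein v (n := 4) (by norm_num) a hroot hbound hlt
  rw [ha0, Valuation.map_neg, map_div₀, hv256, div_one, Valuation.map_pow, ← pow_mul] at h
  exact h

/-- **The uniformiser power**: under the same hypotheses and `y² = x³ − 1`, `y ≠ 0` and `v(x/y)²⁴ = v 5`: `v(y)² = v(x)³` since
`v(x⁻³) < 1`. (In `ℚ₅(ω)(E₀[5])`: `x/y` has normalised order `1/24`, the extension is totally ramified of degree `24`.)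
[cite: Serre1979, Ch. I §6] -/
theorem val_div_pow_of_psi_five (h5 : v 5 < 1) {x y : F}
    (hx : 5 * x ^ 12 - 380 * x ^ 9 - 240 * x ^ 6 + 1600 * x ^ 3 - 256 = 0)
    (hy : y ^ 2 = x ^ 3 - 1) : y ≠ 0 ∧ v (x / y) ^ 24 = v 5 := by
  obtain ⟨hx0, hval⟩ := val_inv_pow_of_psi_five v h5 hx
  have hvx0 : v x ≠ 0 := (Valuation.ne_zero_iff v).mpr hx0
  -- `v x⁻¹ < 1`
  have hxinv : v x⁻¹ < 1 := by
    by_contra hge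
    push Not at hge
    have : (1 : Γ₀) ≤ v x⁻¹ ^ 12 := one_le_pow₀ hge
    rw [hval] at this
    exact absurd h5 (not_lt.mpr this)
  -- `v (1 − x⁻³) = 1`, so `v y ^ 2 = v x ^ 3`
  have h1 : v (1 - x⁻¹ ^ 3) = 1 := by
    rw [sub_eq_add_neg]
    refine Valuation.map_one_add_of_lt v ?_
    rw [Valuation.map_neg, Valuation.map_pow]
    exact pow_lt_one₀ zero_le hxinv (by norm_num)
  have hy2 : v y ^ 2 = v x ^ 3 := by
    have : y ^ 2 = x ^ 3 * (1 - x⁻¹ ^ 3) := by rw [hy]; field_simp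
    rw [← Valuation.map_pow, this, Valuation.map_mul, h1, mul_one, Valuation.map_pow]
  have hy0 : y ≠ 0 := by
    intro h0
    rw [h0, Valuation.map_zero, zero_pow two_ne_zero] at hy2
    exact pow_ne_zero 3 hvx0 hy2.symm
  refine ⟨hy0, ?_⟩
  have hvy0 : v y ≠ 0 := (Valuation.ne_zero_iff v).mpr hy0
  -- `v (x/y) ^ 24 = v x ^ 24 / v y ^ 24 = v x ^ 24 / v x ^ 36 = (v x⁻¹) ^ 12`
  rw [map_div₀, div_pow, show (24 : ℕ) = 2 * 12 from rfl, pow_mul (v y), hy2, ← pow_mul, ← hval, map_inv₀, inv_pow]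
  rw [div_eq_iff (pow_ne_zero _ hvx0), show (3 * 12 : ℕ) = 12 + 2 * 12 from rfl, pow_add,
    ← mul_assoc, inv_mul_cancel₀ (pow_ne_zero _ hvx0), one_mul]

end Valued

/-! ## §3 The `5`-division values of the equianharmonic `℘` -/

section Analytic

open scoped PeriodPair
open PeriodPair Literature.NumberTheory.EllipticCurves

/-- The equianharmonic constant is positive: `0 < ϖ₁ = 2^{2/3}Γ(1/3)³/(4π)`. [folklore] -/
theorem varpiRho_pos : 0 < (2 : ℝ) ^ (2 / 3 : ℝ) * Real.Gamma (1 / 3) ^ 3 / (4 * Real.pi) := by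
  have h1 : 0 < (2 : ℝ) ^ (2 / 3 : ℝ) := Real.rpow_pos_of_pos two_pos _
  have h2 : 0 < Real.Gamma (1 / 3) := Real.Gamma_pos_of_pos (by norm_num)
  positivity

/-- **`g₃(ℤρ + ℤ) = 4ϖ₁⁶`** with `ϖ₁ = 2^{2/3}Γ(1/3)³/(4π)` (`(2^{2/3})⁶ = 16`, `EisensteinLattice.g₃_eq_Gamma`:
`g₃ = Γ(1/3)¹⁸/(64π⁶)`). [cite: Waldschmidt2008EllipticSurvey, §2.3 formula (6)] -/
theorem four_mul_varpi_pow_six :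
    4 * (((2 : ℝ) ^ (2 / 3 : ℝ) * Real.Gamma (1 / 3) ^ 3 / (4 * Real.pi) : ℝ) : ℂ) ^ 6 =
      (ofUpperHalfPlane UpperHalfPlane.ρ).g₃ := by
  rw [EisensteinLattice.g₃_eq_Gamma]
  have h16 : ((2 : ℝ) ^ (2 / 3 : ℝ)) ^ 6 = 16 := by
    rw [← Real.rpow_natCast, ← Real.rpow_mul (by norm_num : (0 : ℝ) ≤ 2)]
    rw [show (2 / 3 : ℝ) * ((6 : ℕ) : ℝ) = ((4 : ℕ) : ℝ) by norm_num, Real.rpow_natCast]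
    norm_num
  have hπ : (Real.pi : ℂ) ≠ 0 := Complex.ofReal_ne_zero.mpr Real.pi_ne_zero
  have e : (((2 : ℝ) ^ (2 / 3 : ℝ) * Real.Gamma (1 / 3) ^ 3 / (4 * Real.pi) : ℝ) : ℂ) ^ 6 =
      ((((2 : ℝ) ^ (2 / 3 : ℝ)) ^ 6 : ℝ) : ℂ) * (Real.Gamma (1 / 3) : ℂ) ^ 18 / ((4 : ℂ) ^ 6 * (Real.pi : ℂ) ^ 6) := by
    push_cast
    ring
  rw [e, h16]
  push_cast
  field_simp
  ring

/-- **The `5`-division values of the equianharmonic `℘` are roots of `ψ₅` and lie on `y² = x³ − 1`.** For `w ∉ Λ = ℤρ + ℤ` with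
`5w ∈ Λ`, `x = ℘(w)/ϖ₁²` and `y = ℘′(w)/(2ϖ₁³)` satisfy `ψ₅(x) = 0` and `y² = x³ − 1` (the curve of the lattice `ϖ₁Λ` is `y² = x³ − 1`:
`g₂(ϖ₁Λ) = 0`, `g₃(ϖ₁Λ) = 4`; `PeriodPair.aeval_weierstrassP_ΨSq_eq_zero`, `ΨSq₅ = ψ₅²`).
[cite: SilvermanAEC2009, Exercise 3.7 (f) and Prop. VI.3.6 (b)] -/
theorem psi_five_weierstrassP_div_rho {w : ℂ} (hw : w ∉ (ofUpperHalfPlane UpperHalfPlane.ρ).lattice)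
    (h5w : (5 : ℂ) * w ∈ (ofUpperHalfPlane UpperHalfPlane.ρ).lattice) :
    (5 * (℘[ofUpperHalfPlane UpperHalfPlane.ρ] w / (((2 : ℝ) ^ (2 / 3 : ℝ) * Real.Gamma (1 / 3) ^ 3 / (4 * Real.pi) : ℝ) : ℂ) ^ 2) ^ 12
      - 380 * (℘[ofUpperHalfPlane UpperHalfPlane.ρ] w / (((2 : ℝ) ^ (2 / 3 : ℝ) * Real.Gamma (1 / 3) ^ 3 / (4 * Real.pi) : ℝ) : ℂ) ^ 2) ^ 9
      - 240 * (℘[ofUpperHalfPlane UpperHalfPlane.ρ] w / (((2 : ℝ) ^ (2 / 3 : ℝ) * Real.Gamma (1 / 3) ^ 3 / (4 * Real.pi) : ℝ) : ℂ) ^ 2) ^ 6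
      + 1600 * (℘[ofUpperHalfPlane UpperHalfPlane.ρ] w / (((2 : ℝ) ^ (2 / 3 : ℝ) * Real.Gamma (1 / 3) ^ 3 / (4 * Real.pi) : ℝ) : ℂ) ^ 2) ^ 3
      - 256 = 0) ∧
    (℘'[ofUpperHalfPlane UpperHalfPlane.ρ] w / (2 * (((2 : ℝ) ^ (2 / 3 : ℝ) * Real.Gamma (1 / 3) ^ 3 / (4 * Real.pi) : ℝ) : ℂ) ^ 3)) ^ 2 =
      (℘[ofUpperHalfPlane UpperHalfPlane.ρ] w / (((2 : ℝ) ^ (2 / 3 : ℝ) * Real.Gamma (1 / 3) ^ 3 / (4 * Real.pi) : ℝ) : ℂ) ^ 2) ^ 3 - 1 := by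
  set ϖ : ℂ := (((2 : ℝ) ^ (2 / 3 : ℝ) * Real.Gamma (1 / 3) ^ 3 / (4 * Real.pi) : ℝ) : ℂ) with hϖ
  set x : ℂ := ℘[ofUpperHalfPlane UpperHalfPlane.ρ] w / ϖ ^ 2 with hx
  have hϖ0 : ϖ ≠ 0 := Complex.ofReal_ne_zero.mpr varpiRho_pos.ne'
  have hg3Λ : (ofUpperHalfPlane UpperHalfPlane.ρ).g₃ = 4 * ϖ ^ 6 := by rw [hϖ, four_mul_varpi_pow_six]
  set L' : PeriodPair := (ofUpperHalfPlane UpperHalfPlane.ρ).mulLeft ϖ hϖ0 with hL'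
  have hg2 : L'.g₂ = 0 := by
    rw [hL', PeriodPair.g₂_mulLeft, PeriodPair.g₂_ofUpperHalfPlane_ρ, mul_zero]
  have hg3 : L'.g₃ = 4 := by
    rw [hL', PeriodPair.g₃_mulLeft, hg3Λ]
    field_simp
  have hW : (⟨0, 0, 0, 0, -1⟩ : WeierstrassCurve ℤ).map (algebraMap ℤ ℂ) = L'.curve :=
    PeriodPair.map_eq_curve (by rw [hg2]; norm_num) (by rw [hg3]; norm_num)
  have hw' : ϖ * w ∉ L'.lattice := by
    rw [hL', PeriodPair.mul_mem_mulLeft_lattice]; exact hw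
  have hnw' : (((5 : ℕ) : ℤ) : ℂ) * (ϖ * w) ∈ L'.lattice := by
    rw [show (((5 : ℕ) : ℤ) : ℂ) * (ϖ * w) = ϖ * ((5 : ℂ) * w) by push_cast; ring, hL',
      PeriodPair.mul_mem_mulLeft_lattice]
    exact h5w
  have hroot := PeriodPair.aeval_weierstrassP_ΨSq_eq_zero hW hw' hnw'
  have hPw : ℘[L'] (ϖ * w) = x := by
    rw [hL', PeriodPair.weierstrassP_mulLeft, hx, div_eq_inv_mul]
  rw [hPw, ΨSq_five_equianharmonic, map_pow, pow_eq_zero_iff two_ne_zero, preΨ'_five_equianharmonic] at hroot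
  refine ⟨?_, ?_⟩
  · have h := hroot
    simp only [map_sub, map_add, map_mul, map_pow, aeval_X, map_ofNat] at h
    linear_combination h
  · -- `(℘'/2ϖ³)² = (℘/ϖ²)³ − 1` from `℘'² = 4℘³ − g₂℘ − g₃`, `g₂ = 0`, `g₃ = 4ϖ⁶`
    have hQ := (ofUpperHalfPlane UpperHalfPlane.ρ).derivWeierstrassP_sq w hw
    rw [PeriodPair.g₂_ofUpperHalfPlane_ρ, hg3Λ, zero_mul, sub_zero] at hQ
    rw [hx]
    field_simp
    linear_combination hQ

/-- ★ **The `5`-adic order of the `5`-division values of the equianharmonic `℘`.** For `w ∉ Λ = ℤρ + ℤ` with `5w ∈ Λ` and EVERY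
valuation `v` of `ℂ` with `v 5 < 1`: `x = ℘(w)/ϖ₁²`, `y = ℘′(w)/(2ϖ₁³)` satisfy `x ≠ 0`, `y ≠ 0`, `v(x⁻¹)¹² = v 5` and `v(x/y)²⁴ = v 5` —
normalised orders `−1/12`, `−1/8` and `1/24` for `x`, `y`, `x/y`: the `5`-torsion layer of `y² = x³ − 1` over `ℚ₅(ω)` is totally ramified of
degree `24 = |(ℤ[ω]/5)ˣ|` (the `e` of `…TameResolvent.resolvent_valuation_le` for the `j = 0` cell, with `(·/5)₆ = θ⁴`, `j = 24 − 4k`).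
[cite: SilvermanAEC2009, Thm. V.3.1] [cite: Serre1979, Ch. I §6] -/
theorem val_weierstrassP_five_div_rho {Γ₀ : Type*} [LinearOrderedCommGroupWithZero Γ₀] (v : Valuation ℂ Γ₀) (h5 : v 5 < 1)
    {w : ℂ} (hw : w ∉ (ofUpperHalfPlane UpperHalfPlane.ρ).lattice)
    (h5w : (5 : ℂ) * w ∈ (ofUpperHalfPlane UpperHalfPlane.ρ).lattice) :
    ℘[ofUpperHalfPlane UpperHalfPlane.ρ] w / (((2 : ℝ) ^ (2 / 3 : ℝ) * Real.Gamma (1 / 3) ^ 3 / (4 * Real.pi) : ℝ) : ℂ) ^ 2 ≠ 0 ∧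
    ℘'[ofUpperHalfPlane UpperHalfPlane.ρ] w / (2 * (((2 : ℝ) ^ (2 / 3 : ℝ) * Real.Gamma (1 / 3) ^ 3 / (4 * Real.pi) : ℝ) : ℂ) ^ 3) ≠ 0 ∧
    v (℘[ofUpperHalfPlane UpperHalfPlane.ρ] w / (((2 : ℝ) ^ (2 / 3 : ℝ) * Real.Gamma (1 / 3) ^ 3 / (4 * Real.pi) : ℝ) : ℂ) ^ 2)⁻¹ ^ 12
      = v 5 ∧
    v ((℘[ofUpperHalfPlane UpperHalfPlane.ρ] w / (((2 : ℝ) ^ (2 / 3 : ℝ) * Real.Gamma (1 / 3) ^ 3 / (4 * Real.pi) : ℝ) : ℂ) ^ 2) /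
        (℘'[ofUpperHalfPlane UpperHalfPlane.ρ] w / (2 * (((2 : ℝ) ^ (2 / 3 : ℝ) * Real.Gamma (1 / 3) ^ 3 / (4 * Real.pi) : ℝ) : ℂ) ^ 3))) ^ 24
      = v 5 := by
  obtain ⟨hx, hy⟩ := psi_five_weierstrassP_div_rho hw h5w
  obtain ⟨hx0, hvx⟩ := val_inv_pow_of_psi_five v h5 hx
  obtain ⟨hy0, hvy⟩ := val_div_pow_of_psi_five v h5 hx hy
  exact ⟨hx0, hy0, hvx, hvy⟩

end Analytic

end Summit.BirchSwinnertonDyer.BirchSwinnertonDyer.Theorems.BiquadraticEisensteinDescentManinDatumSupercuspidalCMInertFiveDivisionEisensteinJZero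

end
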